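import Mathlib.LinearAlgebra.PerfectPairing.Basic
import Mathlib.RingTheory.Finiteness.Defs
import Mathlib.Algebra.Ring.NegOnePow
import Mathlib.LinearAlgebra.Dimension.Finrank
import Mathlib.AlgebraicGeometry.ResidueField
import Summits.Ventures.HodgeRepro2.HostAPI.Carriers.AlgebraicGeometry.Motives.Varieties
import Summits.Ventures.HodgeRepro2.HostAPI.Carriers.AlgebraicGeometry.Motives.Cycles
import Summits.Ventures.HodgeRepro2.HostAPI.Carriers.AlgebraicGeometry.Motives.PreWeilCohomology
import Summits.Ventures.HodgeRepro2.HostAPI.Util.ForallBinderLint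
open HostAPI.Carriers

universe u v

open CategoryTheory AlgebraicGeometry MonoidalCategory CartesianMonoidalCategory Opposite
open scoped TensorProduct DirectSum

noncomputable section

namespace HostAPI.Carriers.AlgebraicGeometry.Motives

structure WeilCohomology (k : Type u) [Field k] (K : Type v) [Field K] [CharZero K]
    extends PreWeilCohomology k K where

  cup_assoc : ∀ ⦃n : ℕ⦄ ⦃X : SchemeOver k⦄, IsSmoothProjective n X →
    ∀ ⦃i j l ij jl m : ℕ⦄ (hij : i + j = ij) (hjl : j + l = jl) (h₁ : ij + l = m)
      (h₂ : i + jl = m) (a : toPreWeilCohomology.obj X i) (b : toPreWeilCohomology.obj X j)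
      (c : toPreWeilCohomology.obj X l), cup h₁ (cup hij a b) c = cup h₂ a (cup hjl b c)

  cup_comm : ∀ ⦃n : ℕ⦄ ⦃X : SchemeOver k⦄, IsSmoothProjective n X →
    ∀ ⦃i j m : ℕ⦄ (h : i + j = m) (h' : j + i = m) (a : toPreWeilCohomology.obj X i)
      (b : toPreWeilCohomology.obj X j),
      cup h a b = ((i * j : ℤ).negOnePow : ℤ) • cup h' b a

  one_cup : ∀ ⦃n : ℕ⦄ ⦃X : SchemeOver k⦄, IsSmoothProjective n X →
    ∀ ⦃i : ℕ⦄ (h : 0 + i = i) (a : toPreWeilCohomology.obj X i), cup h (one X) a = a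

  map_one : ∀ ⦃n : ℕ⦄ ⦃X : SchemeOver k⦄, IsSmoothProjective n X →
    ∀ ⦃m : ℕ⦄ ⦃Y : SchemeOver k⦄, IsSmoothProjective m Y → ∀ f : X ⟶ Y,
      toPreWeilCohomology.pullback f 0 (one Y) = one X

  map_cup : ∀ ⦃n : ℕ⦄ ⦃X : SchemeOver k⦄, IsSmoothProjective n X →
    ∀ ⦃m : ℕ⦄ ⦃Y : SchemeOver k⦄, IsSmoothProjective m Y → ∀ (f : X ⟶ Y) ⦃i j l : ℕ⦄
      (h : i + j = l) (a : toPreWeilCohomology.obj Y i) (b : toPreWeilCohomology.obj Y j),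
      toPreWeilCohomology.pullback f l (cup h a b) =
        cup h (toPreWeilCohomology.pullback f i a) (toPreWeilCohomology.pullback f j b)

  finite_obj : ∀ ⦃n : ℕ⦄ ⦃X : SchemeOver k⦄, IsSmoothProjective n X →
    ∀ i : ℕ, Module.Finite K (toPreWeilCohomology.obj X i)

  subsingleton_obj : ∀ ⦃n : ℕ⦄ ⦃X : SchemeOver k⦄, IsSmoothProjective n X →
    ∀ ⦃i : ℕ⦄, 2 * n < i → Subsingleton (toPreWeilCohomology.obj X i)

  bijective_trace : ∀ ⦃n : ℕ⦄ ⦃X : SchemeOver k⦄, IsSmoothProjective n X →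
    Function.Bijective (trace X n)

  isPerfPair_cupPairing : ∀ ⦃n : ℕ⦄ ⦃X : SchemeOver k⦄, IsSmoothProjective n X →
    ∀ (i j : ℕ) (h : i + j = 2 * n), (toPreWeilCohomology.cupPairing X n i j h).IsPerfPair

  bijective_kunnethMap : ∀ ⦃n : ℕ⦄ ⦃X : SchemeOver k⦄, IsSmoothProjective n X →
    ∀ ⦃m : ℕ⦄ ⦃Y : SchemeOver k⦄, IsSmoothProjective m Y →
      ∀ d : ℕ, Function.Bijective (toPreWeilCohomology.kunnethMap X Y d)

  trace_externalCup : ∀ ⦃n : ℕ⦄ ⦃X : SchemeOver k⦄, IsSmoothProjective n X →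
    ∀ ⦃m : ℕ⦄ ⦃Y : SchemeOver k⦄, IsSmoothProjective m Y →
      ∀ (a : toPreWeilCohomology.obj X (2 * n)) (b : toPreWeilCohomology.obj Y (2 * m)),
      trace (X ⊗ Y) (n + m) (toPreWeilCohomology.externalCup X Y (mul_add 2 n m).symm a b) =
        trace X n a * trace Y m b

  cycleClass_of_coheight_eq_zero : ∀ ⦃n : ℕ⦄ ⦃X : SchemeOver k⦄, IsSmoothProjective n X →
    ∀ z : X.left, Order.coheight z = 0 → cycleClass X 0 z = one X

  trace_cycleClass : ∀ ⦃n : ℕ⦄ ⦃X : SchemeOver k⦄, IsSmoothProjective n X →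
    ∀ z : X.left, Order.coheight z = n →
      trace X n (cycleClass X n z) = (X.hom.residueDegree z : K)

  cycleMap_eq_zero_of_mem_ratTrivial : ∀ ⦃n : ℕ⦄ ⦃X : SchemeOver k⦄, IsSmoothProjective n X →
    ∀ (p d : ℕ), p + d = n → ∀ c : AlgebraicCycle X.left ℤ, c ∈ ratTrivial X.left d →
      toPreWeilCohomology.cycleMap X p c = 0

  cycleClass_eq_zero_of_coheight_ne : ∀ ⦃n : ℕ⦄ ⦃X : SchemeOver k⦄, IsSmoothProjective n X →
    ∀ (p : ℕ) (z : X.left), Order.coheight z ≠ p → cycleClass X p z = 0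

  pullback_ratAlgebraicClasses_le : ∀ ⦃n : ℕ⦄ ⦃X : SchemeOver k⦄, IsSmoothProjective n X →
    ∀ ⦃m : ℕ⦄ ⦃Y : SchemeOver k⦄, IsSmoothProjective m Y → ∀ (f : X ⟶ Y) (p : ℕ),
      (toPreWeilCohomology.ratAlgebraicClasses Y p).map
          (toPreWeilCohomology.pullback f (2 * p)).toAddMonoidHom ≤
        toPreWeilCohomology.ratAlgebraicClasses X p

  cup_mem_ratAlgebraicClasses : ∀ ⦃n : ℕ⦄ ⦃X : SchemeOver k⦄, IsSmoothProjective n X →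
    ∀ ⦃p q r : ℕ⦄ (h : p + q = r) (a b : _),
      a ∈ toPreWeilCohomology.ratAlgebraicClasses X p →
      b ∈ toPreWeilCohomology.ratAlgebraicClasses X q →
      cup (show 2 * p + 2 * q = 2 * r by omega) a b ∈
        toPreWeilCohomology.ratAlgebraicClasses X r

  map_ratAlgebraicClasses_of_isInducedBy : ∀ ⦃n : ℕ⦄ ⦃X : SchemeOver k⦄,
    IsSmoothProjective n X → ∀ ⦃m : ℕ⦄ ⦃Y : SchemeOver k⦄, IsSmoothProjective m Y →
      ∀ ⦃c p q j' : ℕ⦄ (u : toPreWeilCohomology.obj (X ⊗ Y) (2 * c))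
        (T : toPreWeilCohomology.obj X (2 * p) →ₗ[K] toPreWeilCohomology.obj Y (2 * q))
        (hj : 2 * q + j' = 2 * m) (hm : 2 * p + 2 * c + j' = 2 * (n + m)),
        u ∈ toPreWeilCohomology.ratAlgebraicClasses (X ⊗ Y) c →
        toPreWeilCohomology.IsInducedBy n m u T hj hm →
        ∀ a ∈ toPreWeilCohomology.ratAlgebraicClasses X p,
          T a ∈ toPreWeilCohomology.ratAlgebraicClasses Y q

  exists_isInducedBy_id : ∀ ⦃n : ℕ⦄ ⦃X : SchemeOver k⦄, IsSmoothProjective n X →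
    ∃ u ∈ toPreWeilCohomology.ratAlgebraicClasses (X ⊗ X) n,
      ∀ (i j' : ℕ) (hj : i + j' = 2 * n),
        toPreWeilCohomology.IsInducedBy n n u
          (LinearMap.id : toPreWeilCohomology.obj X i →ₗ[K] toPreWeilCohomology.obj X i) hj
          (show i + 2 * n + j' = 2 * (n + n) by omega)

  exists_isInducedBy_pullback : ∀ ⦃n : ℕ⦄ ⦃X : SchemeOver k⦄, IsSmoothProjective n X →
    ∀ ⦃m : ℕ⦄ ⦃Y : SchemeOver k⦄, IsSmoothProjective m Y → ∀ f : X ⟶ Y,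
      ∃ u ∈ toPreWeilCohomology.ratAlgebraicClasses (Y ⊗ X) m,
        ∀ (i j' : ℕ) (hj : i + j' = 2 * n),
          toPreWeilCohomology.IsInducedBy m n u (toPreWeilCohomology.pullback f i) hj
            (show i + 2 * m + j' = 2 * (m + n) by omega)

  isHyperplaneClass_nonempty : ∀ ⦃n : ℕ⦄ ⦃X : SchemeOver k⦄, IsSmoothProjective n X →
    1 ≤ n → ∃ η, toPreWeilCohomology.IsHyperplaneClass X η

  trace_pow_of_isHyperplaneClass : ∀ ⦃n : ℕ⦄ ⦃X : SchemeOver k⦄, IsSmoothProjective n X →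
    ∀ η, toPreWeilCohomology.IsHyperplaneClass X η →
      ∃ d : ℕ, 0 < d ∧ trace X n (toPreWeilCohomology.pow X η n) = d

namespace WeilCohomology

variable {k : Type u} [Field k] {K : Type v} [Field K] [CharZero K]

def HasHardLefschetz (W : WeilCohomology k K) : Prop :=
  ∀ ⦃n : ℕ⦄ ⦃X : SchemeOver k⦄, IsSmoothProjective n X →
    ∀ η : W.obj X 2, W.IsHyperplaneClass X η →
      ∀ (i r j : ℕ), i + r = n → ∀ h : i + 2 * r = j,
        Function.Bijective (W.lefschetzPow X η r i j h)

theorem hasHardLefschetz_iff (W : WeilCohomology k K) :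
    W.HasHardLefschetz ↔
      ∀ ⦃n : ℕ⦄ ⦃X : SchemeOver k⦄, IsSmoothProjective n X →
        ∀ η : W.obj X 2, W.IsHyperplaneClass X η →
          ∀ (i r j : ℕ), i + r = n → ∀ h : i + 2 * r = j,
            Function.Bijective (W.lefschetzPow X η r i j h) :=
  Iff.rfl

theorem HasHardLefschetz.bijective_lefschetzPow {W : WeilCohomology k K}
    (hL : W.HasHardLefschetz) {n : ℕ} {X : SchemeOver k} (hX : IsSmoothProjective n X)
    {η : W.obj X 2} (hη : W.IsHyperplaneClass X η) {i r j : ℕ} (hir : i + r = n)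
    (h : i + 2 * r = j) : Function.Bijective (W.lefschetzPow X η r i j h) :=
  hL hX η hη i r j hir h

variable (W : WeilCohomology k K)

def IsHomologicallyTrivial (X : SchemeOver k) (p : ℕ) (c : AlgebraicCycle X.left ℤ) : Prop :=
  W.cycleMap X p c = 0

def IsNumericallyTrivial (n : ℕ) (X : SchemeOver k) (p : ℕ) (c : AlgebraicCycle X.left ℤ) :
    Prop :=
  ∀ (q : ℕ) (h : p + q = n), ∀ c' ∈ cyclesOfCodim X.left q,
    W.cupPairing X n (2 * p) (2 * q) (by omega) (W.cycleMap X p c) (W.cycleMap X q c') = 0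

theorem isNumericallyTrivial_of_isHomologicallyTrivial {n : ℕ} {X : SchemeOver k} {p : ℕ}
    {c : AlgebraicCycle X.left ℤ} (hc : W.IsHomologicallyTrivial X p c) :
    W.IsNumericallyTrivial n X p c := by
  intro q h c' _
  rw [show W.cycleMap X p c = 0 from hc, LinearMap.map_zero, LinearMap.zero_apply]

section ChowGroup

variable {n : ℕ} {X : SchemeOver k}

def cyclesOfDimCycleMap [CompactSpace X.left] (p d : ℕ) :
    ↥(cyclesOfDim X.left d) →+ W.obj X (2 * p) where
  toFun c := W.cycleMap X p c
  map_zero' := W.cycleMap_zero X p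
  map_add' c c' := W.cycleMap_add X p c c'

@[simp]
lemma cyclesOfDimCycleMap_apply [CompactSpace X.left] (p d : ℕ)
    (c : ↥(cyclesOfDim X.left d)) : W.cyclesOfDimCycleMap p d c = W.cycleMap X p c := rfl

def chowGroupCycleMap (hX : IsSmoothProjective n X) [CompactSpace X.left] {p d : ℕ}
    (h : p + d = n) : ChowGroup X.left d →+ W.obj X (2 * p) :=
  QuotientAddGroup.lift _ (W.cyclesOfDimCycleMap p d) fun c hc ↦ by
    rw [AddMonoidHom.mem_ker, cyclesOfDimCycleMap_apply]
    exact W.cycleMap_eq_zero_of_mem_ratTrivial hX p d h c (AddSubgroup.mem_addSubgroupOf.mp hc)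

@[simp]
lemma chowGroupCycleMap_mk (hX : IsSmoothProjective n X) [CompactSpace X.left] {p d : ℕ}
    (h : p + d = n) (c : ↥(cyclesOfDim X.left d)) :
    W.chowGroupCycleMap hX h (ChowGroup.mk X.left d c) = W.cycleMap X p c := rfl

def algebraicLattice_eq_range_chowGroupCycleMap : Prop :=
  ∀ (hX : IsSmoothProjective n X) [CompactSpace X.left] {p d : ℕ} (h : p + d = n),
    W.algebraicLattice X p = (W.chowGroupCycleMap hX h).range

end ChowGroup

section Sanity

variable {n : ℕ} {X : SchemeOver k}

theorem finrank_obj_eq_zero (hX : IsSmoothProjective n X) {i : ℕ} (hi : 2 * n < i) :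
    Module.finrank K (W.obj X i) = 0 := by
  haveI := W.subsingleton_obj hX hi
  exact Module.finrank_zero_of_subsingleton

theorem finrank_obj_two_mul (hX : IsSmoothProjective n X) :
    Module.finrank K (W.obj X (2 * n)) = 1 := by
  rw [← Module.finrank_self K]
  exact LinearEquiv.finrank_eq (LinearEquiv.ofBijective (W.trace X n) (W.bijective_trace hX))

theorem finrank_obj_eq_of_add_eq (hX : IsSmoothProjective n X) {i j : ℕ} (h : i + j = 2 * n) :
    Module.finrank K (W.obj X i) = Module.finrank K (W.obj X j) := by
  haveI := W.finite_obj hX i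
  haveI := W.isPerfPair_cupPairing hX i j h
  exact Module.finrank_of_isPerfPair (W.cupPairing X n i j h)

theorem finrank_obj_zero (hX : IsSmoothProjective n X) : Module.finrank K (W.obj X 0) = 1 := by
  rw [W.finrank_obj_eq_of_add_eq hX (i := 0) (j := 2 * n) (by omega)]
  exact W.finrank_obj_two_mul hX

end Sanity

end WeilCohomology

end HostAPI.Carriers.AlgebraicGeometry.Motives

end
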